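import Summits.ResolutionOfSingularities.KangarooAtlas.MizutaniTheoremF
import Summits.ResolutionOfSingularities.KangarooAtlas.MizutaniConjecture
import HarnessLib

/-!
# Mizutani's conjecture `m(e) = 2p^e − 1` — the lower bound, CONDITIONAL on Oda's dictionary

Cell topic `Summits/ResolutionOfSingularities/KangarooAtlas` (pub-rosobs); namespace
`Summit.ResolutionOfSingularities.KangarooAtlas.Mizutani`.  Part of the Lean transcription of the
in-house note MIZUTANI-PROOF-g59 (AI-written, AI-audited; *AI review is weaker than expert review*; not a
resolution theorem).

`mizutaniLowerBound_of_towerReduction`: **`m(e) ≥ 2p^e − 1` for all `e ≥ 1`** (`MizutaniLowerBound p e` of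
`MizutaniConjecture.lean`) FOLLOWS from THEOREM F (`theoremF_rootTower`, proved) and the displayed
hypothesis `hOda` — the note's PROPOSITION 3.1 with its step (e), i.e. T. Oda's dictionary (Publ. RIMS 19
(1983), Cor. 2.3 p. 1171 and Thm. 3.1 p. 1173, as read in MIZUTANI-PROOF-g59 §3 (a)–(e)): every point `𝔭` of
`ℙ^n_k` whose Hironaka subgroup scheme has exponent in `[e, e₀]` yields a tower `K = L(x^{1/q})` with
`s ≥ 2` directions over an infinite field `L` of characteristic `p` and a GENUINE `ω ∈ K ⊗_L K` of tensor
rank `≤ dim B(𝔭) + 1`.  That dictionary is NOT formalised (it is the cited input of the chain); this file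
only records that it is the LAST missing link.  With Mizutani's attainment (`MizutaniAttained`, cited) it
gives `MizutaniConjecture p e`.

References: [Mizutani1973HironakaGroupSchemes] (Remark 2.10); [Oda1983HironakaGroupSchemeII] (Cor. 2.3,
Thm. 3.1; in-house proof §3).
-/

open MvPolynomial TensorProduct Literature.AlgebraicGeometry.Resolution.HironakaScheme

namespace Summit.ResolutionOfSingularities.KangarooAtlas.Mizutani

universe u

/-- **`m(e) ≥ 2p^e − 1` relative to Oda's dictionary** (MIZUTANI-PROOF-g59 Cor. 3.2 / Cor. 10.1, lower
bound): if every point with Hironaka scheme of exponent in `[e, e₀]` admits the tower reduction of the note's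
Prop. 3.1 (e) (hypothesis `hOda`; Oda 1983-II Cor. 2.3 / Thm. 3.1), then `MizutaniLowerBound p e` holds —
by THEOREM F.  Conditional: `hOda` is a cited, unformalised input.
[cite: Oda1983HironakaGroupSchemeII, Cor. 2.3 (p. 1171) and Thm. 3.1 (p. 1173); in-house proof §3 (a)–(e)] -/
theorem mizutaniLowerBound_of_towerReduction (p : ℕ) [Fact p.Prime] (e : ℕ) (he : 1 ≤ e)
    (hOda : ∀ (k : Type u) [Field k] [CharP k p] (n : ℕ) (𝔭 : Ideal (MvPolynomial (Fin (n + 1)) k))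
      (e₀ : ℕ), IsPoint k 𝔭 → ExponentLE k p 𝔭 e₀ → (∀ e', e' < e → ¬ ExponentLE k p 𝔭 e') →
      ∃ (L K : Type u) (_ : Field L) (_ : Field K) (_ : Algebra L K) (_ : CharP K p) (_ : Infinite L)
        (s : ℕ) (x : Fin s → L) (a : Fin s → K) (h : IsRootTower L K (p ^ e) x a) (ω : K ⊗[L] K),
        2 ≤ s ∧ (∀ M ∈ (h.Omega ω).support, p ^ e ≤ M.degree) ∧
          (∃ M ∈ (h.Omega ω).support, IsGenuine p e M) ∧ tensorRank L ω ≤ hsDimAt k p 𝔭 e₀ + 1) :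
    MizutaniLowerBound.{u} p e := by
  intro k _ _ n 𝔭 e₀ hP he₀ hlt
  obtain ⟨L, K, _, _, _, _, _, s, x, a, h, ω, hs, hdeg, hgen, hrank⟩ := hOda k n 𝔭 e₀ hP he₀ hlt
  have hF := theoremF_rootTower h hs he ω hdeg hgen
  omega

/-- **Mizutani's conjecture relative to the cited facts**: Oda's tower reduction (hypothesis, as above)
and Mizutani's attainment `MizutaniAttained` (his schemes `H_e`, a cited named fact) give
`MizutaniConjecture p e`, i.e. `m(e) = 2p^e − 1` (MIZUTANI-PROOF-g59 Cor. 10.1).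
[cite: Mizutani1973HironakaGroupSchemes, Remark 2.10; Oda1983HironakaGroupSchemeII, Cor. 2.3, Thm. 3.1] -/
theorem mizutaniConjecture_of_towerReduction (p : ℕ) [Fact p.Prime] (e : ℕ) (he : 1 ≤ e)
    (hOda : ∀ (k : Type u) [Field k] [CharP k p] (n : ℕ) (𝔭 : Ideal (MvPolynomial (Fin (n + 1)) k))
      (e₀ : ℕ), IsPoint k 𝔭 → ExponentLE k p 𝔭 e₀ → (∀ e', e' < e → ¬ ExponentLE k p 𝔭 e') →
      ∃ (L K : Type u) (_ : Field L) (_ : Field K) (_ : Algebra L K) (_ : CharP K p) (_ : Infinite L)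
        (s : ℕ) (x : Fin s → L) (a : Fin s → K) (h : IsRootTower L K (p ^ e) x a) (ω : K ⊗[L] K),
        2 ≤ s ∧ (∀ M ∈ (h.Omega ω).support, p ^ e ≤ M.degree) ∧
          (∃ M ∈ (h.Omega ω).support, IsGenuine p e M) ∧ tensorRank L ω ≤ hsDimAt k p 𝔭 e₀ + 1)
    (hAtt : MizutaniAttained.{u} p e) : MizutaniConjecture.{u} p e :=
  ⟨mizutaniLowerBound_of_towerReduction p e he hOda, hAtt⟩

end Summit.ResolutionOfSingularities.KangarooAtlas.Mizutani
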